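import Summits.QuantumFields.YangMills.Theorems.ColdStartUniversalityLatticeLangevinDynkinCellMartingale
import Summits.QuantumFields.YangMills.Theorems.ColdStartUniversalityLatticeLangevinItoProcessMoments
import Literature.Probability.Process.BrownianCellMoments
import HarnessLib

/-!
# Route `ColdStartUniversality`, rung `stub_fixedCutoffMixing` of K_A1 (stmt-QuantumFields-24809):
# bounds for the small terms of one Taylor cell

Helper file (seat `ym-line-csu-p1`, g6) for the `WilsonMeasureLangevinInvariant` wall of the rung
(step 2, Taylor route to Dynkin's formula in expectation, JOINT filtration of a Brownian vector).
Moment tools and the bounds of the "small" terms of the one-cell Taylor decomposition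
(`cell_error_eq`): with `δ = v - u ≤ 1`, `Aᵢ = ∫_{(u,v]} bⁱ` (`|Aᵢ| ≤ Mδ`),
`Nᵢ = ∑_k ΔJ_{ik}`, `Δᵢ = X_vⁱ - X_uⁱ`:

* `integral_abs_le_sqrt_integral_sq`, `integral_abs_pow_three_le` — `E|F| ≤ √(E F²)`,
  `E|F|³ ≤ √(E F²) √(E F⁴)` (Cauchy–Schwarz);
* `integral_abs_martingalePart_le` — `E|Nᵢ| ≤ d M √δ`;
* `abs_integral_driftTerms_le` — `|E[G (AᵢAⱼ + AᵢNⱼ + NᵢAⱼ)]| ≤ C_G M² (δ² + 2 d δ√δ)`;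
* `integral_abs_incr_le`, `integral_abs_incr_pow_three_le` — `E|Δᵢ| ≤ √K₂ √δ` (also at
  intermediate times), `E|Δᵢ|³ ≤ √K₂ √K₄ δ√δ` with `K₂ = 2M² + 2d²M²`, `K₄ = 8M⁴ + 72d⁴M⁴`.

No definition, no sorry, standard axioms.  RECORD-rung plumbing (R3); the Yang–Mills mass gap is
NOT proved.
-/

set_option autoImplicit false

noncomputable section

namespace Summit.QuantumFields.YangMills.Theorems.ColdStartUniversality

open MeasureTheory ProbabilityTheory Filter Finset
open scoped NNReal ENNReal Topology
open Literature.Probability.Process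

section Generic

variable {Ω : Type*} {mΩ : MeasurableSpace Ω} {P : Measure Ω} [IsProbabilityMeasure P]

/-- `E|F| ≤ √(E F²)` on a probability space (Cauchy–Schwarz). [folklore] -/
theorem integral_abs_le_sqrt_integral_sq {F : Ω → ℝ} (hF : MemLp F 2 P) :
    ∫ ω, |F ω| ∂P ≤ Real.sqrt (∫ ω, F ω ^ 2 ∂P) := by
  have hFa : MemLp (fun ω ↦ |F ω|) 2 P := hF.abs
  have h := integral_mul_le_sqrt_mul_sqrt (μ := P) (f := fun ω ↦ |F ω|) (g := fun _ ↦ (1 : ℝ))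
    (fun ω ↦ abs_nonneg _) (fun _ ↦ zero_le_one) hFa (memLp_const 1)
  simp only [mul_one, one_pow, integral_const, probReal_univ, smul_eq_mul, Real.sqrt_one,
    sq_abs] at h
  exact h

/-- `E|F|³ ≤ √(E F²) √(E F⁴)` for `F ∈ L⁴` (Cauchy–Schwarz with `|F| · F²`). [folklore] -/
theorem integral_abs_pow_three_le {F : Ω → ℝ} (hF : MemLp F 4 P) :
    ∫ ω, |F ω| ^ 3 ∂P ≤ Real.sqrt (∫ ω, F ω ^ 2 ∂P) * Real.sqrt (∫ ω, F ω ^ 4 ∂P) := by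
  have hF2 : MemLp F 2 P := hF.mono_exponent (by norm_num)
  have hFsq : MemLp (fun ω ↦ F ω ^ 2) 2 P := by
    have hm : AEStronglyMeasurable (fun ω ↦ F ω ^ 2) P := hF.1.pow 2
    rw [memLp_two_iff_integrable_sq hm]
    have := hF.integrable_norm_pow (by norm_num)
    refine this.congr (ae_of_all _ fun ω ↦ ?_)
    simp only [Real.norm_eq_abs]
    rw [Even.pow_abs (by decide : Even 4)]; ring
  have hFa : MemLp (fun ω ↦ |F ω|) 2 P := hF2.abs
  have h := integral_mul_le_sqrt_mul_sqrt (μ := P) (f := fun ω ↦ |F ω|) (g := fun ω ↦ F ω ^ 2)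
    (fun ω ↦ abs_nonneg _) (fun ω ↦ sq_nonneg _) hFa hFsq
  have e1 : ∀ ω, |F ω| * F ω ^ 2 = |F ω| ^ 3 := fun ω ↦ by
    rw [← sq_abs (F ω)]; ring
  have e2 : ∀ ω, (F ω ^ 2) ^ 2 = F ω ^ 4 := fun ω ↦ by ring
  simp only [e1, e2, sq_abs] at h
  exact h

end Generic

section Vec

variable {Ω : Type*} {mΩ : MeasurableSpace Ω} {P : Measure Ω} [IsProbabilityMeasure P] {d : ℕ}
  {W : ℝ≥0 → Ω → (Fin d → ℝ)} {M : ℝ} {u v : ℝ≥0}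

/-- **Mean absolute martingale part of a cell**: `E|∑_k (J_k(v) - J_k(u))| ≤ d M √(v - u)` for
`J_k = ∫ σ_k dW^k`, `|σ_k| ≤ M`. [folklore] -/
theorem integral_abs_martingalePart_le (hW : IsBrownianVec W P) {σ J : Fin d → ℝ≥0 → Ω → ℝ}
    (hσ : ∀ k, IsStronglyProgressive hW.natFiltration (σ k)) (hσM : ∀ k r ω, |σ k r ω| ≤ M)
    (hJ : ∀ k, IsItoIntegral (σ k) (fun r ω => W r ω k) (J k) hW.natFiltration P) (hM0 : 0 ≤ M)
    (huv : u ≤ v) :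
    ∫ ω, |∑ k, (J k v ω - J k u ω)| ∂P ≤ d * (M * Real.sqrt ((v : ℝ) - u)) := by
  have hB := fun k ↦ martingale_coord hW k
  have hBsq := fun k ↦ martingale_coord_sq_sub hW k
  have hB2 := fun k (r : ℝ≥0) ↦ memLp_two_coord hW r k
  have hBc := fun k ↦ continuous_coord hW k
  have hJ2 : ∀ k (r : ℝ≥0), MemLp (J k r) 2 P := fun k r ↦
    IsItoIntegral.memLp_two (hB k) (hBsq k) (hB2 k) (hBc k) (hσ k) (sqErr_ne_top_of_bdd (hσM k)) (hJ k) r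
  have hN2 : ∀ k, MemLp (fun ω ↦ J k v ω - J k u ω) 2 P := fun k ↦ (hJ2 k v).sub (hJ2 k u)
  have hk : ∀ k, ∫ ω, |J k v ω - J k u ω| ∂P ≤ M * Real.sqrt ((v : ℝ) - u) := by
    intro k
    refine (integral_abs_le_sqrt_integral_sq (hN2 k)).trans ?_
    have h2 := IsItoIntegral.integral_sub_sq_le (hB k) (hBsq k) (hB2 k) (hBc k) (hσ k) (hσM k) (hJ k) huv
    calc Real.sqrt (∫ ω, (J k v ω - J k u ω) ^ 2 ∂P) ≤ Real.sqrt (M ^ 2 * ((v : ℝ) - u)) :=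
          Real.sqrt_le_sqrt h2
      _ = M * Real.sqrt ((v : ℝ) - u) := by
          rw [Real.sqrt_mul (sq_nonneg _), Real.sqrt_sq hM0]
  calc ∫ ω, |∑ k, (J k v ω - J k u ω)| ∂P ≤ ∫ ω, ∑ k, |J k v ω - J k u ω| ∂P :=
        integral_mono_of_nonneg (ae_of_all _ fun ω ↦ abs_nonneg _)
          (integrable_finsetSum _ fun k _ ↦ ((hN2 k).integrable one_le_two).abs)
          (ae_of_all _ fun ω ↦ abs_sum_le_sum_abs _ _)
    _ = ∑ k, ∫ ω, |J k v ω - J k u ω| ∂P :=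
        integral_finsetSum _ fun k _ ↦ ((hN2 k).integrable one_le_two).abs
    _ ≤ ∑ _k : Fin d, M * Real.sqrt ((v : ℝ) - u) := sum_le_sum fun k _ ↦ hk k
    _ = d * (M * Real.sqrt ((v : ℝ) - u)) := by rw [sum_const, card_univ, Fintype.card_fin, nsmul_eq_mul]

/-- **Drift terms of a cell**: for `|G| ≤ CG` measurable, `|Aᵢ|, |Aⱼ| ≤ M δ` measurable and
`Nᵢ, Nⱼ` integrable with `E|N| ≤ ρN`:
`|E[G (Aᵢ Aⱼ + Aᵢ Nⱼ + Nᵢ Aⱼ)]| ≤ CG ((Mδ)² + 2 (Mδ) ρN)`. [folklore] -/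
theorem abs_integral_driftTerms_le {G Ai Aj Ni Nj : Ω → ℝ} {CG A ρN : ℝ}
    (hGm : AEStronglyMeasurable G P) (hG : ∀ ω, |G ω| ≤ CG)
    (hAim : AEStronglyMeasurable Ai P) (hAjm : AEStronglyMeasurable Aj P)
    (hAi : ∀ ω, |Ai ω| ≤ A) (hAj : ∀ ω, |Aj ω| ≤ A) (hA0 : 0 ≤ A)
    (hNi : Integrable Ni P) (hNj : Integrable Nj P)
    (hNiρ : ∫ ω, |Ni ω| ∂P ≤ ρN) (hNjρ : ∫ ω, |Nj ω| ∂P ≤ ρN) :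
    |∫ ω, G ω * (Ai ω * Aj ω + Ai ω * Nj ω + Ni ω * Aj ω) ∂P| ≤ CG * (A ^ 2 + 2 * (A * ρN)) := by
  obtain ⟨ω₀, -⟩ := nonempty_of_measure_ne_zero (μ := P) (s := Set.univ)
    (by rw [measure_univ]; exact one_ne_zero)
  have hCG0 : 0 ≤ CG := (abs_nonneg _).trans (hG ω₀)
  have hbdd : ∀ {φ : Ω → ℝ} {K : ℝ}, AEStronglyMeasurable φ P → (∀ ω, |φ ω| ≤ K) → Integrable φ P :=
    fun {φ K} hφ hK ↦ (integrable_const K).mono' hφ (ae_of_all _ fun ω ↦ by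
      rw [Real.norm_eq_abs]; exact hK ω)
  have iGAA : Integrable (fun ω ↦ G ω * (Ai ω * Aj ω)) P :=
    hbdd (hGm.mul (hAim.mul hAjm)) (K := CG * (A * A)) fun ω ↦ by
      rw [abs_mul, abs_mul]
      exact mul_le_mul (hG ω) (mul_le_mul (hAi ω) (hAj ω) (abs_nonneg _) hA0)
        (mul_nonneg (abs_nonneg _) (abs_nonneg _)) hCG0
  have hGAb : ∀ ω, ‖G ω * Ai ω‖ ≤ CG * A := fun ω ↦ by
    rw [Real.norm_eq_abs, abs_mul]; exact mul_le_mul (hG ω) (hAi ω) (abs_nonneg _) hCG0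
  have hGAb' : ∀ ω, ‖G ω * Aj ω‖ ≤ CG * A := fun ω ↦ by
    rw [Real.norm_eq_abs, abs_mul]; exact mul_le_mul (hG ω) (hAj ω) (abs_nonneg _) hCG0
  have iGAN : Integrable (fun ω ↦ G ω * Ai ω * Nj ω) P :=
    hNj.bdd_mul (hGm.mul hAim) (ae_of_all _ hGAb)
  have iGNA : Integrable (fun ω ↦ G ω * Aj ω * Ni ω) P :=
    hNi.bdd_mul (hGm.mul hAjm) (ae_of_all _ hGAb')
  have hsplit : ∀ ω, G ω * (Ai ω * Aj ω + Ai ω * Nj ω + Ni ω * Aj ω) =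
      G ω * (Ai ω * Aj ω) + G ω * Ai ω * Nj ω + G ω * Aj ω * Ni ω := fun ω ↦ by ring
  simp_rw [hsplit]
  have i12 : Integrable (fun ω ↦ G ω * (Ai ω * Aj ω) + G ω * Ai ω * Nj ω) P := iGAA.add iGAN
  rw [integral_add i12 iGNA, integral_add iGAA iGAN]
  have b1 : |∫ ω, G ω * (Ai ω * Aj ω) ∂P| ≤ CG * A ^ 2 := by
    have h := norm_integral_le_of_norm_le_const (μ := P) (f := fun ω ↦ G ω * (Ai ω * Aj ω))
      (C := CG * A ^ 2) (ae_of_all _ fun ω ↦ by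
        rw [Real.norm_eq_abs, abs_mul, abs_mul, sq]
        exact mul_le_mul (hG ω) (mul_le_mul (hAi ω) (hAj ω) (abs_nonneg _) hA0)
          (mul_nonneg (abs_nonneg _) (abs_nonneg _)) hCG0)
    simpa [Real.norm_eq_abs] using h
  have b2 : |∫ ω, G ω * Ai ω * Nj ω ∂P| ≤ CG * A * ρN := by
    calc |∫ ω, G ω * Ai ω * Nj ω ∂P| ≤ ∫ ω, |G ω * Ai ω * Nj ω| ∂P := by
          simpa only [Real.norm_eq_abs] using norm_integral_le_integral_norm (fun ω ↦ G ω * Ai ω * Nj ω)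
      _ ≤ ∫ ω, CG * A * |Nj ω| ∂P := by
          refine integral_mono iGAN.abs (hNj.abs.const_mul _) fun ω ↦ ?_
          simp only
          rw [abs_mul]
          exact mul_le_mul_of_nonneg_right (by simpa [Real.norm_eq_abs] using hGAb ω) (abs_nonneg _)
      _ = CG * A * ∫ ω, |Nj ω| ∂P := integral_const_mul _ _
      _ ≤ CG * A * ρN := mul_le_mul_of_nonneg_left hNjρ (mul_nonneg hCG0 hA0)
  have b3 : |∫ ω, G ω * Aj ω * Ni ω ∂P| ≤ CG * A * ρN := by
    calc |∫ ω, G ω * Aj ω * Ni ω ∂P| ≤ ∫ ω, |G ω * Aj ω * Ni ω| ∂P := by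
          simpa only [Real.norm_eq_abs] using norm_integral_le_integral_norm (fun ω ↦ G ω * Aj ω * Ni ω)
      _ ≤ ∫ ω, CG * A * |Ni ω| ∂P := by
          refine integral_mono iGNA.abs (hNi.abs.const_mul _) fun ω ↦ ?_
          simp only
          rw [abs_mul]
          exact mul_le_mul_of_nonneg_right (by simpa [Real.norm_eq_abs] using hGAb' ω) (abs_nonneg _)
      _ = CG * A * ∫ ω, |Ni ω| ∂P := integral_const_mul _ _
      _ ≤ CG * A * ρN := mul_le_mul_of_nonneg_left hNiρ (mul_nonneg hCG0 hA0)
  calc |∫ ω, G ω * (Ai ω * Aj ω) ∂P + ∫ ω, G ω * Ai ω * Nj ω ∂P + ∫ ω, G ω * Aj ω * Ni ω ∂P|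
      ≤ |∫ ω, G ω * (Ai ω * Aj ω) ∂P| + |∫ ω, G ω * Ai ω * Nj ω ∂P| + |∫ ω, G ω * Aj ω * Ni ω ∂P| :=
        (abs_add_le _ _).trans (by gcongr; exact abs_add_le _ _)
    _ ≤ CG * A ^ 2 + CG * A * ρN + CG * A * ρN := add_le_add (add_le_add b1 b2) b3
    _ = CG * (A ^ 2 + 2 * (A * ρN)) := by ring

/-- **Mean oscillation and third absolute moment of the increments of an Itô process with bounded
coefficients**, over a cell of length `≤ 1`: with `K₂ = 2M² + 2d²M²`, `K₄ = 8M⁴ + 72d⁴M⁴`,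
for `u ≤ r ≤ v`, `v - u ≤ 1`: `E|x_r - x_u| ≤ √K₂ √(v-u)` and `E|x_v - x_u|³ ≤ √K₂ √K₄ (v-u)√(v-u)`.
[folklore] -/
theorem integral_abs_incr_le (hW : IsBrownianVec W P) {x : ℝ≥0 → Ω → ℝ} {β : ℝ≥0 → Ω → ℝ}
    {σ J : Fin d → ℝ≥0 → Ω → ℝ}
    (hβ : IsStronglyProgressive hW.natFiltration β) (hσ : ∀ k, IsStronglyProgressive hW.natFiltration (σ k))
    (hβM : ∀ r ω, |β r ω| ≤ M) (hσM : ∀ k r ω, |σ k r ω| ≤ M)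
    (hJ : ∀ k, IsItoIntegral (σ k) (fun r ω => W r ω k) (J k) hW.natFiltration P)
    (hx : ∀ᵐ ω ∂P, ∀ t, x t ω = x 0 ω + (∫ r in (0 : ℝ)..t, β r.toNNReal ω) + ∑ k, J k t ω)
    {r : ℝ≥0} (hur : u ≤ r) (hrv : r ≤ v) (hδ1 : (v : ℝ) - u ≤ 1) :
    ∫ ω, |x r ω - x u ω| ∂P ≤
      Real.sqrt (2 * M ^ 2 + 2 * (d : ℝ) ^ 2 * M ^ 2) * Real.sqrt ((v : ℝ) - u) := by
  obtain ⟨h4, h2, -⟩ := incr_moments hW hβ hσ hβM hσM hJ hx hur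
  have hru : 0 ≤ (r : ℝ) - u := sub_nonneg.2 (NNReal.coe_le_coe.2 hur)
  have hrδ : (r : ℝ) - u ≤ (v : ℝ) - u := sub_le_sub_right (NNReal.coe_le_coe.2 hrv) _
  have hr1 : (r : ℝ) - u ≤ 1 := hrδ.trans hδ1
  refine (integral_abs_le_sqrt_integral_sq (h4.mono_exponent (by norm_num))).trans ?_
  rw [← Real.sqrt_mul (by positivity)]
  refine Real.sqrt_le_sqrt (h2.trans ?_)
  have hsq : ((r : ℝ) - u) ^ 2 ≤ (v : ℝ) - u := by nlinarith
  have a1 := mul_le_mul_of_nonneg_left hsq (by positivity : (0 : ℝ) ≤ 2 * M ^ 2)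
  have a2 := mul_le_mul_of_nonneg_left hrδ (by positivity : (0 : ℝ) ≤ 2 * (d : ℝ) ^ 2 * M ^ 2)
  nlinarith [a1, a2]

/-- Third absolute moment of the increment over a cell of length `≤ 1` (see `integral_abs_incr_le`).
[folklore] -/
theorem integral_abs_incr_pow_three_le (hW : IsBrownianVec W P) {x : ℝ≥0 → Ω → ℝ} {β : ℝ≥0 → Ω → ℝ}
    {σ J : Fin d → ℝ≥0 → Ω → ℝ}
    (hβ : IsStronglyProgressive hW.natFiltration β) (hσ : ∀ k, IsStronglyProgressive hW.natFiltration (σ k))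
    (hβM : ∀ r ω, |β r ω| ≤ M) (hσM : ∀ k r ω, |σ k r ω| ≤ M)
    (hJ : ∀ k, IsItoIntegral (σ k) (fun r ω => W r ω k) (J k) hW.natFiltration P)
    (hx : ∀ᵐ ω ∂P, ∀ t, x t ω = x 0 ω + (∫ r in (0 : ℝ)..t, β r.toNNReal ω) + ∑ k, J k t ω)
    (huv : u ≤ v) (hδ1 : (v : ℝ) - u ≤ 1) :
    ∫ ω, |x v ω - x u ω| ^ 3 ∂P ≤
      Real.sqrt (2 * M ^ 2 + 2 * (d : ℝ) ^ 2 * M ^ 2) * Real.sqrt (8 * M ^ 4 + 72 * (d : ℝ) ^ 4 * M ^ 4) *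
        (((v : ℝ) - u) * Real.sqrt ((v : ℝ) - u)) := by
  obtain ⟨h4, h2, h4b⟩ := incr_moments hW hβ hσ hβM hσM hJ hx huv
  set δ : ℝ := (v : ℝ) - u with hδ
  have hδ0 : 0 ≤ δ := sub_nonneg.2 (NNReal.coe_le_coe.2 huv)
  refine (integral_abs_pow_three_le h4).trans ?_
  have e2 : ∫ ω, (x v ω - x u ω) ^ 2 ∂P ≤ (2 * M ^ 2 + 2 * (d : ℝ) ^ 2 * M ^ 2) * δ := by
    refine h2.trans ?_
    have hsq : δ ^ 2 ≤ δ := by nlinarith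
    have a1 := mul_le_mul_of_nonneg_left hsq (by positivity : (0 : ℝ) ≤ 2 * M ^ 2)
    nlinarith [a1]
  have e4 : ∫ ω, (x v ω - x u ω) ^ 4 ∂P ≤ (8 * M ^ 4 + 72 * (d : ℝ) ^ 4 * M ^ 4) * δ ^ 2 := by
    refine h4b.trans ?_
    have hδ2 : δ ^ 2 ≤ 1 := by nlinarith
    have hsq : δ ^ 4 ≤ δ ^ 2 := by
      have := mul_le_mul_of_nonneg_left hδ2 (sq_nonneg δ)
      nlinarith [this]
    have a1 := mul_le_mul_of_nonneg_left hsq (by positivity : (0 : ℝ) ≤ 8 * M ^ 4)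
    nlinarith [a1]
  calc Real.sqrt (∫ ω, (x v ω - x u ω) ^ 2 ∂P) * Real.sqrt (∫ ω, (x v ω - x u ω) ^ 4 ∂P)
      ≤ Real.sqrt ((2 * M ^ 2 + 2 * (d : ℝ) ^ 2 * M ^ 2) * δ) *
          Real.sqrt ((8 * M ^ 4 + 72 * (d : ℝ) ^ 4 * M ^ 4) * δ ^ 2) :=
        mul_le_mul (Real.sqrt_le_sqrt e2) (Real.sqrt_le_sqrt e4) (Real.sqrt_nonneg _) (Real.sqrt_nonneg _)
    _ = Real.sqrt (2 * M ^ 2 + 2 * (d : ℝ) ^ 2 * M ^ 2) * Real.sqrt (8 * M ^ 4 + 72 * (d : ℝ) ^ 4 * M ^ 4) *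
          (δ * Real.sqrt δ) := by
        rw [Real.sqrt_mul (by positivity), Real.sqrt_mul (by positivity), Real.sqrt_sq hδ0]
        ring

end Vec

end Summit.QuantumFields.YangMills.Theorems.ColdStartUniversality

end
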